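import Mathlib
import Summits.NavierStokesRegularity.NavierStokesRegularity.Theorems.WakeRatchetTailRatchetRelayAdjoint
import HarnessLib

/-!
# `WakeRatchet.TailRatchet` (stmt-NavierStokesRegularity-21808): TRANSVERSALITY of the bordered
# linearisation at the relay profile — `∫_{−∞}^0 w₁(t)(1 + t/2)e^{t} dt < 0`

Support file for the crux `TailRatchet` (route `WakeRatchet`; MODEL lattice ODEs of Tao 2016 §1.2, §4 —
nothing in this file is a statement about the Navier–Stokes equations, and no item is closed here).

Context (files `WakeRatchetTailRatchetRelayProfile`, `…RelayAdjoint`; census of stmt-21808, programme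
"R-lac"): at lacunarity `δ = Λ⁻² = 0` the normalised scalar front equation of the construction item
`DyadicScalarFronts`, `G_δ(b,s) = b' − (4/s²)b(t/s)² + 4sδ·b(t)b(st)`, has the exact solution
`(b₀,s₀) = (e^{t},2)` (relay profile).  Its linearisation `L₀h = h' − 2e^{t/2}h(t/2)` has kernel
`span{(1+t)e^{t}}` and a one-dimensional co-kernel spanned by the adjoint mode `w₁`
(`WakeRatchetRelayAdjoint.adjoint_hasDerivAt`: `w₁' = −4e^{t}w₁(2t)`, `w₁(−∞) = 1`), and
`∂_sG₀(b₀,·)|_{s=2} = (1 + t/2)e^{t}` (`WakeRatchetRelayProfile.relay_dGds`).  The bordered operator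
`(h,σ) ↦ L₀h + σ·(1+t/2)e^{t}` is onto iff the TRANSVERSALITY NUMBER
`τ := ∫_{−∞}^{0} w₁(t) (1 + t/2) e^{t} dt`
is non-zero.  This file EVALUATES it as an explicit convergent series and proves it is negative:

* `integral_weight_exp_mul` — `∫_{(−∞,0]} (1 + t/2)e^{kt} dt = 1/k − 1/(2k²)` (`k > 0`), with the
  integrability lemmas it needs (`integrableOn_mul_exp_mul_Iic`, `integral_mul_exp_mul_Iic`:
  `∫_{(−∞,0]} t e^{kt} dt = −1/k²`, via the reflection `t ↦ −t` and `Γ(2) = 1`);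
* `transversality_eq_tsum` — **`τ = Σ_m c_m (2^{−m} − ½·4^{−m})`**, `c_m = ∏_{i<m}(−4)/(2^{i+1}−1)`
  (termwise integration, justified by `Σ_m ∫‖·‖ ≤ Σ_m 3|c_m| < ∞`);
* `transversality_neg` — **`τ < 0`** (indeed `τ ≤ −1411/9765 + 15/16384 < −0.143`: six exact terms
  plus the geometric tail bound `|c_m| ≤ 210·4^{−m}`); paper value `τ = −½∏_{i≥1}(1−2^{−i}) ≈ −0.1444`.

CONSEQUENCE (recorded, not formalised here): the implicit-function / continuation construction of
scalar dyadic fronts for LACUNARY `Λ` (small `δ`) is non-degenerate at its base point; what it still needs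
is a `C¹` functional setting for `G_δ` on a weighted space of profiles on `(−∞,0]` (loss of one derivative
in `s` is absorbed by the smoothing of `b ↦ ∫ b(·/s)²`).  Fronts for lacunary `Λ` do NOT refute
`TailRatchet` (which needs `Λ → 1`); they are the far end of a continuation in `Λ`.

HONEST FRAMING: elementary real analysis; MODEL lattice only; the construction item and the crux stay open.
-/

noncomputable section

set_option linter.dupNamespace false

namespace Summit.NavierStokesRegularity.NavierStokesRegularity.Theorems

namespace WakeRatchetRelayTransversality

open MeasureTheory Set Filter Topology Real
open WakeRatchetRelayAdjoint

/-! ## One-dimensional integrals on `(−∞, 0]` -/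

/-- `∫_{(−∞,0]} e^{kt} dt = 1/k` for `k > 0`. [folklore] -/
theorem integral_exp_mul_Iic_zero {k : ℝ} (hk : 0 < k) :
    ∫ t in Iic (0 : ℝ), Real.exp (k * t) = 1 / k := by
  rw [integral_exp_mul_Iic hk, mul_zero, Real.exp_zero]

/-- The key pointwise bound `|t| e^{kt} ≤ (2/k) e^{(k/2)t}` on `t ≤ 0`. [folklore] -/
theorem abs_mul_exp_le {k : ℝ} (hk : 0 < k) {t : ℝ} (ht : t ≤ 0) :
    |t| * Real.exp (k * t) ≤ 2 / k * Real.exp (k / 2 * t) := by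
  have h1 : k / 2 * (-t) + 1 ≤ Real.exp (k / 2 * (-t)) := Real.add_one_le_exp _
  have habs : |t| = -t := abs_of_nonpos ht
  have h2 : -t ≤ 2 / k * Real.exp (k / 2 * (-t)) := by
    have h3 : -t = 2 / k * (k / 2 * (-t)) := by field_simp
    have h4 : 2 / k * (k / 2 * (-t)) ≤ 2 / k * (k / 2 * (-t) + 1) :=
      mul_le_mul_of_nonneg_left (by linarith) (by positivity)
    calc -t = 2 / k * (k / 2 * (-t)) := h3
      _ ≤ 2 / k * (k / 2 * (-t) + 1) := h4
      _ ≤ 2 / k * Real.exp (k / 2 * (-t)) := mul_le_mul_of_nonneg_left h1 (by positivity)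
  have hexp : Real.exp (k / 2 * (-t)) * Real.exp (k * t) = Real.exp (k / 2 * t) := by
    rw [← Real.exp_add]; ring_nf
  rw [habs]
  calc -t * Real.exp (k * t) ≤ 2 / k * Real.exp (k / 2 * (-t)) * Real.exp (k * t) :=
        mul_le_mul_of_nonneg_right h2 (Real.exp_pos _).le
    _ = 2 / k * Real.exp (k / 2 * t) := by rw [mul_assoc, hexp]

/-- `t e^{kt}` is integrable on `(−∞,0]` for `k > 0`. [folklore] -/
theorem integrableOn_mul_exp_mul_Iic {k : ℝ} (hk : 0 < k) :
    IntegrableOn (fun t : ℝ => t * Real.exp (k * t)) (Iic 0) := by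
  have hg : IntegrableOn (fun t : ℝ => 2 / k * Real.exp (k / 2 * t)) (Iic 0) :=
    (integrableOn_exp_mul_Iic (by positivity : 0 < k / 2) 0).const_mul _
  refine Integrable.mono' hg ?_ ?_
  · exact (continuous_id.mul (Real.continuous_exp.comp (continuous_const.mul continuous_id))).aestronglyMeasurable
  · refine (ae_restrict_iff' measurableSet_Iic).2 (Eventually.of_forall fun t ht => ?_)
    rw [norm_mul, Real.norm_eq_abs, Real.norm_eq_abs, abs_of_pos (Real.exp_pos _)]
    exact abs_mul_exp_le hk ht

/-- `∫_{(−∞,0]} t e^{kt} dt = −1/k²` for `k > 0` (reflection `t ↦ −t` and `Γ(2) = 1`). [folklore] -/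
theorem integral_mul_exp_mul_Iic {k : ℝ} (hk : 0 < k) :
    ∫ t in Iic (0 : ℝ), t * Real.exp (k * t) = -(1 / k ^ 2) := by
  have h1 : (∫ t in Iic (0 : ℝ), t * Real.exp (k * t)) =
      ∫ x in Ioi (0 : ℝ), (-x) * Real.exp (k * (-x)) := by
    rw [integral_comp_neg_Ioi 0 (fun t : ℝ => t * Real.exp (k * t)), neg_zero]
  have h2 : (fun x : ℝ => (-x) * Real.exp (k * (-x))) =
      fun x : ℝ => -(x ^ ((2 : ℝ) - 1) * Real.exp (-(k * x))) := by
    funext x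
    rw [show (2 : ℝ) - 1 = 1 by norm_num, Real.rpow_one]
    ring_nf
  rw [h1, h2, integral_neg, Real.integral_rpow_mul_exp_neg_mul_Ioi (by norm_num) hk,
    Real.Gamma_two, Real.rpow_two]
  ring

/-- The weight `(1 + t/2)e^{kt}` is integrable on `(−∞,0]` for `k > 0`. [folklore] -/
theorem integrableOn_weight_exp_mul {k : ℝ} (hk : 0 < k) :
    IntegrableOn (fun t : ℝ => (1 + t / 2) * Real.exp (k * t)) (Iic 0) := by
  have h : (fun t : ℝ => (1 + t / 2) * Real.exp (k * t)) =
      fun t : ℝ => Real.exp (k * t) + 1 / 2 * (t * Real.exp (k * t)) := by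
    funext t; ring
  rw [h]
  exact (integrableOn_exp_mul_Iic hk 0).add ((integrableOn_mul_exp_mul_Iic hk).const_mul _)

/-- **`∫_{(−∞,0]} (1 + t/2) e^{kt} dt = 1/k − 1/(2k²)`** for `k > 0`. [folklore] -/
theorem integral_weight_exp_mul {k : ℝ} (hk : 0 < k) :
    ∫ t in Iic (0 : ℝ), (1 + t / 2) * Real.exp (k * t) = 1 / k - 1 / (2 * k ^ 2) := by
  have h : (fun t : ℝ => (1 + t / 2) * Real.exp (k * t)) =
      fun t : ℝ => Real.exp (k * t) + 1 / 2 * (t * Real.exp (k * t)) := by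
    funext t; ring
  rw [h, integral_add (integrableOn_exp_mul_Iic hk 0) ((integrableOn_mul_exp_mul_Iic hk).const_mul _),
    integral_const_mul, integral_exp_mul_Iic_zero hk, integral_mul_exp_mul_Iic hk]
  ring

/-- Bound for the absolute weight: `∫_{(−∞,0]} |1 + t/2| e^{kt} dt ≤ 3` for `k ≥ 1`. [folklore] -/
theorem integral_abs_weight_exp_mul_le {k : ℝ} (hk1 : 1 ≤ k) :
    ∫ t in Iic (0 : ℝ), |1 + t / 2| * Real.exp (k * t) ≤ 3 := by
  have hk : 0 < k := by linarith
  have hmaj : IntegrableOn (fun t : ℝ => Real.exp (k * t) + Real.exp (k / 2 * t)) (Iic 0) :=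
    (integrableOn_exp_mul_Iic hk 0).add (integrableOn_exp_mul_Iic (by positivity : 0 < k / 2) 0)
  have habs : IntegrableOn (fun t : ℝ => |1 + t / 2| * Real.exp (k * t)) (Iic 0) := by
    have hn : IntegrableOn (fun t : ℝ => ‖(1 + t / 2) * Real.exp (k * t)‖) (Iic 0) :=
      (integrableOn_weight_exp_mul hk).norm
    refine IntegrableOn.congr_fun hn (fun t _ => ?_) measurableSet_Iic
    rw [norm_mul, Real.norm_eq_abs, Real.norm_eq_abs, abs_of_pos (Real.exp_pos _)]
  have hle : ∀ t ∈ Iic (0 : ℝ), |1 + t / 2| * Real.exp (k * t) ≤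
      Real.exp (k * t) + Real.exp (k / 2 * t) := by
    intro t ht
    have h1 : |1 + t / 2| ≤ 1 + |t| / 2 := by
      calc |1 + t / 2| ≤ |1| + |t / 2| := abs_add_le _ _
        _ = 1 + |t| / 2 := by rw [abs_one, abs_div, abs_two]
    have h2 := abs_mul_exp_le hk (show t ≤ 0 from ht)
    have h3 : |t| / 2 * Real.exp (k * t) ≤ 1 / k * Real.exp (k / 2 * t) := by
      have : |t| / 2 * Real.exp (k * t) = 1 / 2 * (|t| * Real.exp (k * t)) := by ring
      rw [this]
      calc 1 / 2 * (|t| * Real.exp (k * t)) ≤ 1 / 2 * (2 / k * Real.exp (k / 2 * t)) :=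
            mul_le_mul_of_nonneg_left h2 (by norm_num)
        _ = 1 / k * Real.exp (k / 2 * t) := by ring
    have h4 : 1 / k * Real.exp (k / 2 * t) ≤ 1 * Real.exp (k / 2 * t) := by
      refine mul_le_mul_of_nonneg_right ?_ (Real.exp_pos _).le
      rw [div_le_iff₀ hk]; linarith
    calc |1 + t / 2| * Real.exp (k * t) ≤ (1 + |t| / 2) * Real.exp (k * t) :=
          mul_le_mul_of_nonneg_right h1 (Real.exp_pos _).le
      _ = Real.exp (k * t) + |t| / 2 * Real.exp (k * t) := by ring
      _ ≤ Real.exp (k * t) + Real.exp (k / 2 * t) := by linarith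
  have hk2 : 0 < k / 2 := by positivity
  have hA : 1 / k ≤ 1 := by rw [div_le_iff₀ hk]; linarith
  have hB : 1 / (k / 2) ≤ 2 := by rw [div_le_iff₀ hk2]; linarith
  calc ∫ t in Iic (0 : ℝ), |1 + t / 2| * Real.exp (k * t)
      ≤ ∫ t in Iic (0 : ℝ), (Real.exp (k * t) + Real.exp (k / 2 * t)) :=
        setIntegral_mono_on habs hmaj measurableSet_Iic hle
    _ = 1 / k + 1 / (k / 2) := by
        rw [integral_add (integrableOn_exp_mul_Iic hk 0) (integrableOn_exp_mul_Iic hk2 0),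
          integral_exp_mul_Iic_zero hk, integral_exp_mul_Iic_zero hk2]
    _ ≤ 3 := by linarith

/-! ## The terms `F_m(t) = c_m e^{(2^m−1)t} · (1 + t/2)e^{t} = c_m (1 + t/2) e^{2^m t}` -/

/-- Merging the exponentials: `c_m e^{(2^m−1)t}·(1+t/2)e^{t} = c_m (1+t/2) e^{2^m t}`. [folklore] -/
theorem term_weight_eq (m : ℕ) (t : ℝ) :
    (∏ i ∈ Finset.range m, ((-4 : ℝ) / (2 ^ (i + 1) - 1))) * Real.exp ((2 ^ m - 1) * t) *
        ((1 + t / 2) * Real.exp t) =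
      (∏ i ∈ Finset.range m, ((-4 : ℝ) / (2 ^ (i + 1) - 1))) *
        ((1 + t / 2) * Real.exp (2 ^ m * t)) := by
  have h : Real.exp ((2 ^ m - 1) * t) * Real.exp t = Real.exp (2 ^ m * t) := by
    rw [← Real.exp_add]; congr 1; ring
  calc (∏ i ∈ Finset.range m, ((-4 : ℝ) / (2 ^ (i + 1) - 1))) * Real.exp ((2 ^ m - 1) * t) *
        ((1 + t / 2) * Real.exp t)
      = (∏ i ∈ Finset.range m, ((-4 : ℝ) / (2 ^ (i + 1) - 1))) *
          ((1 + t / 2) * (Real.exp ((2 ^ m - 1) * t) * Real.exp t)) := by ring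
    _ = _ := by rw [h]

/-- `2^m ≥ 1 > 0`. [folklore] -/
theorem one_le_two_pow_real (m : ℕ) : (1 : ℝ) ≤ 2 ^ m := one_le_pow₀ (by norm_num)

/-- Each term is integrable on `(−∞,0]`. [folklore] -/
theorem term_integrableOn (m : ℕ) :
    IntegrableOn (fun t : ℝ =>
      (∏ i ∈ Finset.range m, ((-4 : ℝ) / (2 ^ (i + 1) - 1))) * Real.exp ((2 ^ m - 1) * t) *
        ((1 + t / 2) * Real.exp t)) (Iic 0) := by
  have h : (fun t : ℝ =>
      (∏ i ∈ Finset.range m, ((-4 : ℝ) / (2 ^ (i + 1) - 1))) * Real.exp ((2 ^ m - 1) * t) *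
        ((1 + t / 2) * Real.exp t)) = fun t : ℝ =>
      (∏ i ∈ Finset.range m, ((-4 : ℝ) / (2 ^ (i + 1) - 1))) *
        ((1 + t / 2) * Real.exp (2 ^ m * t)) := funext fun t => term_weight_eq m t
  rw [h]
  exact (integrableOn_weight_exp_mul (lt_of_lt_of_le one_pos (one_le_two_pow_real m))).const_mul _

/-- **Termwise integral: `∫_{(−∞,0]} F_m = c_m (2^{−m} − ½·4^{−m})`.** [folklore] -/
theorem term_integral (m : ℕ) :
    ∫ t in Iic (0 : ℝ),
      (∏ i ∈ Finset.range m, ((-4 : ℝ) / (2 ^ (i + 1) - 1))) * Real.exp ((2 ^ m - 1) * t) *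
        ((1 + t / 2) * Real.exp t) =
      (∏ i ∈ Finset.range m, ((-4 : ℝ) / (2 ^ (i + 1) - 1))) *
        (1 / 2 ^ m - 1 / (2 * (2 ^ m) ^ 2)) := by
  have h : (fun t : ℝ =>
      (∏ i ∈ Finset.range m, ((-4 : ℝ) / (2 ^ (i + 1) - 1))) * Real.exp ((2 ^ m - 1) * t) *
        ((1 + t / 2) * Real.exp t)) = fun t : ℝ =>
      (∏ i ∈ Finset.range m, ((-4 : ℝ) / (2 ^ (i + 1) - 1))) *
        ((1 + t / 2) * Real.exp (2 ^ m * t)) := funext fun t => term_weight_eq m t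
  rw [h, integral_const_mul, integral_weight_exp_mul (lt_of_lt_of_le one_pos (one_le_two_pow_real m))]

/-- Norm of a term: `‖F_m(t)‖ = |c_m| · |1+t/2| e^{2^m t}`. [folklore] -/
theorem term_norm_eq (m : ℕ) (t : ℝ) :
    ‖(∏ i ∈ Finset.range m, ((-4 : ℝ) / (2 ^ (i + 1) - 1))) * Real.exp ((2 ^ m - 1) * t) *
        ((1 + t / 2) * Real.exp t)‖ =
      |∏ i ∈ Finset.range m, ((-4 : ℝ) / (2 ^ (i + 1) - 1))| * (|1 + t / 2| * Real.exp (2 ^ m * t)) := by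
  rw [term_weight_eq, norm_mul, Real.norm_eq_abs, Real.norm_eq_abs, abs_mul, abs_of_pos (Real.exp_pos _)]

/-- **`∫_{(−∞,0]} ‖F_m‖ ≤ 3|c_m|`.** [folklore] -/
theorem term_norm_integral_le (m : ℕ) :
    ∫ t in Iic (0 : ℝ),
      ‖(∏ i ∈ Finset.range m, ((-4 : ℝ) / (2 ^ (i + 1) - 1))) * Real.exp ((2 ^ m - 1) * t) *
        ((1 + t / 2) * Real.exp t)‖ ≤
      3 * |∏ i ∈ Finset.range m, ((-4 : ℝ) / (2 ^ (i + 1) - 1))| := by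
  simp_rw [term_norm_eq]
  rw [integral_const_mul]
  have h := integral_abs_weight_exp_mul_le (one_le_two_pow_real m)
  have h0 : 0 ≤ |∏ i ∈ Finset.range m, ((-4 : ℝ) / (2 ^ (i + 1) - 1))| := abs_nonneg _
  calc |∏ i ∈ Finset.range m, ((-4 : ℝ) / (2 ^ (i + 1) - 1))| *
        ∫ t in Iic (0 : ℝ), |1 + t / 2| * Real.exp (2 ^ m * t)
      ≤ |∏ i ∈ Finset.range m, ((-4 : ℝ) / (2 ^ (i + 1) - 1))| * 3 := mul_le_mul_of_nonneg_left h h0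
    _ = 3 * |∏ i ∈ Finset.range m, ((-4 : ℝ) / (2 ^ (i + 1) - 1))| := mul_comm _ _

/-- **The norms of the termwise integrals are summable** (`≤ 630·4^{−m}`). [folklore] -/
theorem summable_term_norm_integral :
    Summable (fun m : ℕ => ∫ t in Iic (0 : ℝ),
      ‖(∏ i ∈ Finset.range m, ((-4 : ℝ) / (2 ^ (i + 1) - 1))) * Real.exp ((2 ^ m - 1) * t) *
        ((1 + t / 2) * Real.exp t)‖) := by
  refine Summable.of_nonneg_of_le (fun m => integral_nonneg fun t => norm_nonneg _)
    (fun m => (term_norm_integral_le m).trans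
      (mul_le_mul_of_nonneg_left (coeff_abs_le m) (by norm_num))) ?_
  exact summable_majorant.mul_left 3

/-! ## The transversality number as a series -/

/-- **TRANSVERSALITY NUMBER AS A SERIES.**
`∫_{(−∞,0]} w₁(t)(1 + t/2)e^{t} dt = Σ_m c_m (2^{−m} − ½·4^{−m})`, where
`w₁ = Σ_m c_m e^{(2^m−1)t}` is the adjoint mode of `WakeRatchetRelayAdjoint`.
[cite: Tao2016AveragedNS, §1.2 (dyadic model); cell vocabulary (bordered linearisation of the scalar front equation of `DyadicScalarFronts` at the relay profile)] -/
theorem transversality_eq_tsum :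
    ∫ t in Iic (0 : ℝ), (∑' m : ℕ,
        (∏ i ∈ Finset.range m, ((-4 : ℝ) / (2 ^ (i + 1) - 1))) * Real.exp ((2 ^ m - 1) * t)) *
      ((1 + t / 2) * Real.exp t) =
    ∑' m : ℕ, (∏ i ∈ Finset.range m, ((-4 : ℝ) / (2 ^ (i + 1) - 1))) *
      (1 / 2 ^ m - 1 / (2 * (2 ^ m) ^ 2)) := by
  have h : (fun t : ℝ => (∑' m : ℕ,
        (∏ i ∈ Finset.range m, ((-4 : ℝ) / (2 ^ (i + 1) - 1))) * Real.exp ((2 ^ m - 1) * t)) *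
      ((1 + t / 2) * Real.exp t)) = fun t : ℝ => ∑' m : ℕ,
        (∏ i ∈ Finset.range m, ((-4 : ℝ) / (2 ^ (i + 1) - 1))) * Real.exp ((2 ^ m - 1) * t) *
          ((1 + t / 2) * Real.exp t) := by
    funext t; rw [tsum_mul_right]
  rw [h, ← integral_tsum_of_summable_integral_norm term_integrableOn summable_term_norm_integral]
  exact tsum_congr term_integral

/-! ## The sign: six exact terms and a geometric tail -/

/-- Termwise bound `|c_m (2^{−m} − ½·4^{−m})| ≤ 210 · 8^{−m}`. [folklore] -/
theorem tsum_term_abs_le (m : ℕ) :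
    ‖(∏ i ∈ Finset.range m, ((-4 : ℝ) / (2 ^ (i + 1) - 1))) * (1 / 2 ^ m - 1 / (2 * (2 ^ m) ^ 2))‖ ≤
      210 / 8 ^ m := by
  rw [Real.norm_eq_abs, abs_mul]
  have h2 : (0 : ℝ) < 2 ^ m := by positivity
  have hb0 : 0 ≤ 1 / (2 : ℝ) ^ m - 1 / (2 * (2 ^ m) ^ 2) := by
    rw [sub_nonneg, div_le_div_iff₀ (by positivity) h2]
    nlinarith [one_le_two_pow_real m]
  have hb1 : 1 / (2 : ℝ) ^ m - 1 / (2 * (2 ^ m) ^ 2) ≤ 1 / 2 ^ m := by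
    have : 0 ≤ 1 / (2 * ((2 : ℝ) ^ m) ^ 2) := by positivity
    linarith
  rw [abs_of_nonneg hb0]
  have h8 : (8 : ℝ) ^ m = 4 ^ m * 2 ^ m := by rw [← mul_pow]; norm_num
  calc |∏ i ∈ Finset.range m, ((-4 : ℝ) / (2 ^ (i + 1) - 1))| * (1 / 2 ^ m - 1 / (2 * (2 ^ m) ^ 2))
      ≤ 210 / 4 ^ m * (1 / 2 ^ m) := mul_le_mul (coeff_abs_le m) hb1 hb0 (by positivity)
    _ = 210 / 8 ^ m := by rw [h8]; field_simp

/-- The series of the transversality number converges absolutely. [folklore] -/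
theorem summable_tsum_term :
    Summable (fun m : ℕ => (∏ i ∈ Finset.range m, ((-4 : ℝ) / (2 ^ (i + 1) - 1))) *
      (1 / 2 ^ m - 1 / (2 * (2 ^ m) ^ 2))) := by
  have hg : Summable (fun m : ℕ => (210 : ℝ) / 8 ^ m) := by
    have h : Summable (fun m : ℕ => (210 : ℝ) * (1 / 8) ^ m) :=
      (summable_geometric_of_lt_one (by norm_num) (by norm_num)).mul_left 210
    refine h.congr fun m => ?_
    rw [one_div, inv_pow, div_eq_mul_inv]
  exact Summable.of_norm_bounded hg tsum_term_abs_le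

/-- The first six terms, exactly: `Σ_{m<6} c_m(2^{−m} − ½·4^{−m}) = −1411/9765 ≈ −0.14450`. [folklore] -/
theorem head_six_eq :
    ∑ m ∈ Finset.range 6, (∏ i ∈ Finset.range m, ((-4 : ℝ) / (2 ^ (i + 1) - 1))) *
      (1 / 2 ^ m - 1 / (2 * (2 ^ m) ^ 2)) = -1411 / 9765 := by
  simp only [Finset.sum_range_succ, Finset.sum_range_zero, Finset.prod_range_succ,
    Finset.prod_range_zero]
  norm_num

/-- The tail after six terms is at most `15/16384 ≈ 0.00092` in absolute value. [folklore] -/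
theorem tail_six_abs_le :
    ‖∑' m : ℕ, (∏ i ∈ Finset.range (m + 6), ((-4 : ℝ) / (2 ^ (i + 1) - 1))) *
      (1 / 2 ^ (m + 6) - 1 / (2 * (2 ^ (m + 6)) ^ 2))‖ ≤ 15 / 16384 := by
  have hgeo : HasSum (fun m : ℕ => (210 : ℝ) / 8 ^ 6 * (1 / 8) ^ m) (210 / 8 ^ 6 * (1 - 1 / 8)⁻¹) :=
    (hasSum_geometric_of_lt_one (by norm_num) (by norm_num)).mul_left _
  have hval : (210 : ℝ) / 8 ^ 6 * (1 - 1 / 8)⁻¹ = 15 / 16384 := by norm_num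
  have hfun : (fun m : ℕ => (210 : ℝ) / 8 ^ 6 * (1 / 8) ^ m) = fun m : ℕ => (210 : ℝ) / 8 ^ (m + 6) := by
    funext m
    rw [pow_add, one_div, inv_pow]
    field_simp
  rw [hval, hfun] at hgeo
  exact tsum_of_norm_bounded hgeo fun m => tsum_term_abs_le (m + 6)

/-- **THE TRANSVERSALITY NUMBER IS NEGATIVE** (as a series): `Σ_m c_m(2^{−m} − ½·4^{−m}) < 0`
(indeed `≤ −1411/9765 + 15/16384 < −0.143`; paper value `−½∏_{i≥1}(1−2^{−i}) ≈ −0.1444`). [folklore] -/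
theorem tsum_neg :
    ∑' m : ℕ, (∏ i ∈ Finset.range m, ((-4 : ℝ) / (2 ^ (i + 1) - 1))) *
      (1 / 2 ^ m - 1 / (2 * (2 ^ m) ^ 2)) < 0 := by
  rw [← summable_tsum_term.sum_add_tsum_nat_add 6, head_six_eq]
  have htail := tail_six_abs_le
  rw [Real.norm_eq_abs] at htail
  have := (abs_le.1 htail).2
  linarith

/-- **TRANSVERSALITY.**  The bordered linearisation of the drain-free scalar front problem at the relay
profile is non-degenerate: the adjoint mode `w₁` does not annihilate the bordering direction
`∂_sG = (1 + t/2)e^{t}`, precisely `∫_{(−∞,0]} w₁(t)(1 + t/2)e^{t} dt < 0`.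
[cite: Tao2016AveragedNS, §1.2 (dyadic model); cell vocabulary (bordered linearisation of the scalar front equation of `DyadicScalarFronts` at the relay profile; programme R-lac of the census of stmt-21808)] -/
theorem transversality_neg :
    ∫ t in Iic (0 : ℝ), (∑' m : ℕ,
        (∏ i ∈ Finset.range m, ((-4 : ℝ) / (2 ^ (i + 1) - 1))) * Real.exp ((2 ^ m - 1) * t)) *
      ((1 + t / 2) * Real.exp t) < 0 := by
  rw [transversality_eq_tsum]
  exact tsum_neg

/-- The transversality number is non-zero. [folklore] -/
theorem transversality_ne_zero :
    ∫ t in Iic (0 : ℝ), (∑' m : ℕ,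
        (∏ i ∈ Finset.range m, ((-4 : ℝ) / (2 ^ (i + 1) - 1))) * Real.exp ((2 ^ m - 1) * t)) *
      ((1 + t / 2) * Real.exp t) ≠ 0 :=
  transversality_neg.ne

end WakeRatchetRelayTransversality

end Summit.NavierStokesRegularity.NavierStokesRegularity.Theorems

end
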